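import Summits.BirchSwinnertonDyer.BirchSwinnertonDyer.Theorems.ByReductionTypeAtTwoSupersingularFlatCapstoneCore
import Summits.BirchSwinnertonDyer.BirchSwinnertonDyer.Theorems.ByReductionTypeAtTwoSupersingularFlatCapstoneCoprime
import Summits.BirchSwinnertonDyer.BirchSwinnertonDyer.Theorems.ByReductionTypeAtTwoSupersingularFlatImageDoor
import Summits.BirchSwinnertonDyer.BirchSwinnertonDyer.Theorems.ByReductionTypeAtTwoSupersingularFlatReciprocityConstantPeriod
import Summits.BirchSwinnertonDyer.BirchSwinnertonDyer.Theorems.ByReductionTypeAtTwoSupersingularFlatRoad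
import Summits.BirchSwinnertonDyer.BirchSwinnertonDyer.Theorems.ByReductionTypeAtTwoSupersingularHondaSystemAtTwoLogsAdic
import Summits.BirchSwinnertonDyer.BirchSwinnertonDyer.Theorems.ThetaPartnerAtTwoSignedKatoUpToAtTwoLocalCyclotomicVariable
import Summits.BirchSwinnertonDyer.BirchSwinnertonDyer.Theorems.ThetaPartnerAtTwoSignedKatoUpToAtTwoKatoBKCuspBrick
import Literature.NumberTheory.EllipticCurves.Kato2004.EulerSystemTatePairingValuesTwo
import HarnessLib

/-!
# Route `ByReductionTypeAtTwo` (rung K4), crux `SupersingularRankZeroAtTwo` (item stmt-BirchSwinnertonDyer-19097), line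
# `odd_blind_package` v2.20 → v2.21, stub 2/5 — **THE CAPSTONE WITH THE (α) RESIDUE**: LITERALLY the body of `FlatZetaPackageAtTwo`
# (v2.20 39efd4f3 :1565–1593, EXACT F3b) for the habitat curve, from THREE PRINT NAMES — Kato's (KZ) Tate-pairing value law at `2`
# (`Kato2004.exists_eulerSystem_expStar_tatePairing_values_two`), Kato 12.4 (`Kato2004.thm12_4`), Abbes–Ullmo 1996 Thm. A
# (`abbesUllmo_not_dvd_maninConstant_of_not_dvd_level`) — and ONE research hypothesis, the x-free (α):
# «for the LOG-PINNED Sprung–Honda system, μ(Col♭(loc 𝐇¹(T₂E))) = 0», i.e. `∃ e : I.H, (J (L e)).2 ∉ Ideal.span {C 2}`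
# (cell `bsd-2adic`, seat `bsd-2adic-ss-1` GEN 26 = LEAD of 19097; D-0182 wind-down: finish-and-book; `--supports 19097`, helper)

HONEST FRAMING (D-0054): THEOREMS ONLY — no definition, no named fact, no instance, no notation, no `sorry`.  CONSUMER file in t42 GEN 52's
frame: the proof is C3c ★★★ `SSFlatCap.flatZetaPackage_body_pow_two_of_print` VERBATIM through the print data (E0b's system and model ∘
`LocalVar.exists_localVariable_two` ∘ the K3 frames ∘ `hP` ∘ `KatoConst.exists_ratCast_eq_katoConstant_of_analyticRank_eq_zero` ∘ `KatoBK.cuspBrick_of_isNewformOf`),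
then C3a's core (`exists_lifts_levelCongruences_of_katoFamily`), C2's `hcop_of_cuspFamily`, tower-1 GEN 70's period theorem
(`SSFlatERL.padicValRat_periodRatio_nonneg_of_goodSS_two_of_abbesUllmo`) and the LEAD's (α) door ★★★ `SSFlatFold.flatZeta_fblock_of_levelCongruences_of_flatImage`.
(Name: `…_of_pinnedFlatImage` — t42 GEN 52's C3d ★★★ p838998 `flatZetaPackage_body_of_flatImage` is the E0b-FREE twin with a STRONGER `hα`
over all Honda systems; REF1 R540a / director (1029): only the PINNED form may be registry text.)  The hypothesis `hα` quantifies over E0b-TYPE DATA (Sprung's `2`-adic model system with its logarithms and its transport to `ℚ_v` — the clause list of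
★ `SSHondaTwo.isHondaSystemAtTwo_sprung_withLog` VERBATIM), which LOG-PINS the Honda system `c` (no off-diagonal instance: t42 GEN 51 (R∀), pen RC-854/860/861),
and over the PINNED `I`, `L`, `J` (one instance up to equality: ★ p838373 `eq_of_pin`, Sprung Prop. 5.7); its body is the single research conjunct.
Its text is the body of the LEAD's v2.21 `def FlatColemanImagePrimitiveAtTwo`.  Closes NO stub by itself (the LEAD's v2.21 registry touch re-types
stub 2 to (α) and moves the three print names to `stub_pub`); 19097 stays OPEN; nothing booked; BSD₂ is proved for no supersingular curve and BSD for no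
curve by any of this; typed ≠ proved.

References: [Kato2004Asterisque] K. Kato, Astérisque 295 (2004), Thm. 12.4–12.6 (pp. 221–222), Thm. 6.6 (1), Thm. 9.7, Ex. 13.3, §13.9–13.14
(pp. 229–234); [Sprung2012] Thm. 2.2, Def. 7.1, Thm. 7.14, 7.16; [Sprung2017] Thm. 1.12, Cor. 4.4–4.5; [Kobayashi2003] Thm. 6.3, (8.23);
[AgasheRibetStein2006] Thm. 2.5 (= Abbes–Ullmo 1996 Thm. A); [MazurTateTeitelbaum1986Invent] §I.10, §I.13.
-/

set_option autoImplicit false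
-- the Theorems namespace of this sub repeats the summit name by design (D-0017 nested layout)
set_option linter.dupNamespace false

noncomputable section

set_option backward.isDefEq.respectTransparency false

open scoped Classical MatrixGroups ModularForm NumberField TensorProduct

namespace Summit.BirchSwinnertonDyer.BirchSwinnertonDyer.Theorems.SSFlatCap

open CongruenceSubgroup WeierstrassCurve Field IsDedekindDomain NumberField Polynomial
  Literature.NumberTheory.GaloisRepresentations
  Literature.NumberTheory.EllipticCurves Literature.NumberTheory.EllipticCurves.ModularForms
  Literature.NumberTheory.EllipticCurves.Module Literature.NumberTheory.EllipticCurves.Rank1Residual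
  Literature.NumberTheory.EllipticCurves.Kobayashi2003 Literature.NumberTheory.EllipticCurves.Kato2004
  Literature.NumberTheory.EllipticCurves.Kato2004.EulerSystemValues Literature.NumberTheory.EllipticCurves.Sprung2012
  Literature.NumberTheory.EllipticCurves.Sprung2017
  Literature.NumberTheory.EllipticCurves.FormalGroupChart
  ZpExtension
  Summit.BirchSwinnertonDyer.Rank1Residual.Additive Summit.BirchSwinnertonDyer.Rank1Residual.Additive.PadicCyclotomicTower
  Summit.BirchSwinnertonDyer.Rank1Residual.Additive.BallEval
  Summit.BirchSwinnertonDyer.Rank1Residual.F1Sign2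
  Summit.BirchSwinnertonDyer.BirchSwinnertonDyer.Theorems.SignedKatoOffTwo.LocalTwo
  Summit.BirchSwinnertonDyer.BirchSwinnertonDyer.Theorems.SignedKatoOffTwo
  Summit.BirchSwinnertonDyer.BirchSwinnertonDyer.Theorems.SignedKatoOffTwo.KatoBK
  Summit.BirchSwinnertonDyer.BirchSwinnertonDyer.Theorems.SSFlatERL

section Door

/-! ## THE CAPSTONE WITH THE (α) RESIDUE -/

/-- ★★★ **THE BODY OF `FlatZetaPackageAtTwo` (EXACT F3b) FROM THREE PRINT NAMES AND (α).**  For the habitat curve (`r_an = 0`, good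
supersingular `2`), the cyclotomic `(κ, γ)`, `v ∋ 2`, any local lift `g`: from Kato's (KZ) value law at `2` (`hP`), Kato 12.4 (`h124`), Abbes–Ullmo
1996 Thm. A (`hAU`) and the research hypothesis (α) «μ(Col♭(loc 𝐇¹(T₂E))) = 0 for the LOG-PINNED Sprung–Honda system» (`hα`, over E0b-type data and the
pinned `I`, `L`, `J`): LITERALLY `∃ cneg c, IsHondaSystemAtTwo … ∧ (∀ f ϖ Ls Lf [inst] I L, pin → ∀ J, hJ → ∃ Z G, (∃ z ∈ Z, (J (L z)).2 = G) ∧ ι G = C ϖ·ι L♭ ∧ ZL2)`.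
Proof = t42 GEN 52's C3c through the print data, C3a's core, C2's `hcop`, tower-1 GEN 70's `0 ≤ v₂(ϖ)` from Abbes–Ullmo, and the LEAD's (α) door.
[cite: Kato2004Asterisque, Thm. 12.4 (2), Thm. 12.5 (1)(4), Thm. 12.6, §13.9, §13.12–13.14 (pp. 230–234)] [cite: Sprung2012, Thm. 2.2, Def. 7.1, Thm. 7.14, 7.16]
[cite: Sprung2017, Thm. 1.12, Cor. 4.4–4.5] [cite: Kobayashi2003, Thm. 6.3, (8.23)] [cite: AgasheRibetStein2006, Thm. 2.5] -/
theorem flatZetaPackage_body_of_pinnedFlatImage (hP : Kato2004.exists_eulerSystem_expStar_tatePairing_values_two)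
    (h124 : Kato2004.thm12_4) (hAU : abbesUllmo_not_dvd_maninConstant_of_not_dvd_level) (W : WeierstrassCurve ℚ) [W.IsElliptic] [W.IsGloballyMinimal]
    (hr : W.analyticRank = 0) (hss : GoodSS W 2)
    (κ : ZpExtension ℚ 2) (γ : Field.absoluteGaloisGroup ℚ) (hκ : κ.IsCyclotomic) (hγ : κ.IsTopGenerator γ)
    (hγ' : IsCyclotomicVariable 2 γ) (v : HeightOneSpectrum (𝓞 ℚ)) (hv : (2 : 𝓞 ℚ) ∈ v.asIdeal)
    (g : Field.absoluteGaloisGroup (v.adicCompletion ℚ))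
    (hg : κ.IsTopGenerator (resGalOfEmb (closureEmb (K := ℚ) (v.adicCompletion ℚ)) g))
    -- (α) for the LOG-PINNED Sprung–Honda system: over E0b-type data (clauses VERBATIM) and the pinned `I`, `L`, `J`
    (hα : ∀ (Φ : AlgebraicClosure ℚ_[2] ≃ₐ[ℚ] AlgebraicClosure (v.adicCompletion ℚ)) (φ : ℚ_[2] ≃+* v.adicCompletion ℚ)
      (_ : ∀ t : ℚ_[2], Φ (algebraMap ℚ_[2] (AlgebraicClosure ℚ_[2]) t) =
        algebraMap (v.adicCompletion ℚ) (AlgebraicClosure (v.adicCompletion ℚ)) (φ t))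
      (ι : AlgebraicClosure ℚ →ₐ[ℚ] AlgebraicClosure ℚ_[2])
      (_ : ∀ z, closureEmb (K := ℚ) (v.adicCompletion ℚ) z = Φ (ι z))
      (x : ℕ → ℚ_[2]) (y : ℕ → localPoints W ℚ_[2]) (σ : ℕ → absoluteGaloisGroup ℚ_[2]) (N : ℕ)
      (d₀ : ℕ → localPoints W ℚ_[2]) (cneg : localPoints W (v.adicCompletion ℚ)) (c : ℕ → localPoints W (v.adicCompletion ℚ)),

      (x 0 = 1 ∧ (2 : ℚ_[2]) * x 1 = W.frobeniusTrace 2 ∧ ∀ k, (2 : ℚ_[2]) * x (k + 2) = W.frobeniusTrace 2 * x (k + 1) - x k) ∧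
      (haveI := isIntegral_genFib_baseChange 2 ((integralModelInt W).map (Int.castRingHom ℤ_[2]))
        ∀ m, (toLoc ((genFibΩ_eq_baseChange ((integralModelInt W).map (Int.castRingHom ℤ_[2]))).trans
              (baseChange_twoAdicModel W))).symm (y m) ∈
            subfieldPoints (genFibΩ 2 ((integralModelInt W).map (Int.castRingHom ℤ_[2]))) (layer 2 m).toSubfield
              coeffs_mem_layer ∧
          (toLoc ((genFibΩ_eq_baseChange ((integralModelInt W).map (Int.castRingHom ℤ_[2]))).trans
              (baseChange_twoAdicModel W))).symm (y m) ∈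
            kernel (Valued.v (R := PadicAlgCl 2)) (genFibΩ 2 ((integralModelInt W).map (Int.castRingHom ℤ_[2]))) ∧
          ptLogΩ 2 ((integralModelInt W).map (Int.castRingHom ℤ_[2]))
            ((toLoc ((genFibΩ_eq_baseChange ((integralModelInt W).map (Int.castRingHom ℤ_[2]))).trans
              (baseChange_twoAdicModel W))).symm (y m)) =
            ∑ k ∈ Finset.range m, algebraMap ℚ_[2] (PadicAlgCl 2) (x k) * (zeta 2 (m - k) - 1)) ∧
      (∀ m, ∀ τ ∈ stab 2 m, τ • y m = y m) ∧
      (∀ m, 1 ≤ m → σ m • zeta 2 m = (zeta 2 m)⁻¹) ∧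
      ((N : ℤ) = 3 - W.frobeniusTrace 2 ∧ Odd N) ∧
      (∀ n, d₀ n = N • (y (n + 2) + σ (n + 2) • y (n + 2)) - 2 • y 1) ∧
      (∀ m, d₀ m ∈ localLayerPointsOfEmb κ ι W m) ∧
      cneg = WeierstrassCurve.Affine.Point.map (W' := W)
        (Φ : AlgebraicClosure ℚ_[2] →ₐ[ℚ] AlgebraicClosure (v.adicCompletion ℚ))
        (show (W.baseChange (AlgebraicClosure ℚ_[2])).toAffine.Point from (-y 1)) ∧
      (∀ m, c m = WeierstrassCurve.Affine.Point.map (W' := W)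
        (Φ : AlgebraicClosure ℚ_[2] →ₐ[ℚ] AlgebraicClosure (v.adicCompletion ℚ))
        (show (W.baseChange (AlgebraicClosure ℚ_[2])).toAffine.Point from d₀ m)) ∧
      IsHondaSystemAtTwo κ (closureEmb (K := ℚ) (v.adicCompletion ℚ)) W (W.frobeniusTrace 2) g cneg c  →
      ∀ [ContinuousSMul ℤ_[2] (W.tateModule 2)] (I : Kato2004.IwasawaH1Data W 2 κ γ)
        (L : letI := moduleOfGenerator κ (closureEmb (K := ℚ) (v.adicCompletion ℚ)) W hg
          I.H →ₗ[IwasawaAlgebra 2] (localTowerPointsOfEmb κ (closureEmb (K := ℚ) (v.adicCompletion ℚ)) W →+ ℤ_[2])),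
        (∀ (x : I.H) (n k : ℕ) (Q : localPoints W (v.adicCompletion ℚ))
            (hQ : Q ∈ localLayerPointsOfEmb κ (closureEmb (K := ℚ) (v.adicCompletion ℚ)) W n),
            PadicInt.toZModPow k (L x ⟨Q, localLayerPointsOfEmb_le_localTowerPointsOfEmb κ _ W n hQ⟩) =
              CyclotomicLayer.tatePairingPk W κ v n k (I.proj n x) ⟨Q, hQ⟩) →
      ∀ (J : letI := moduleOfGenerator κ (closureEmb (K := ℚ) (v.adicCompletion ℚ)) W hg
          (localTowerPointsOfEmb κ (closureEmb (K := ℚ) (v.adicCompletion ℚ)) W →+ ℤ_[2]) →ₗ[IwasawaAlgebra 2]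
            IwasawaAlgebra 2 × IwasawaAlgebra 2),
        (∀ w, IsColemanPair κ (closureEmb (K := ℚ) (v.adicCompletion ℚ)) W (W.frobeniusTrace 2) g c w (J w).1 (J w).2) →
        ∃ e : I.H, (J (L e)).2 ∉ Ideal.span {(PowerSeries.C (2 : ℤ_[2]) : IwasawaAlgebra 2)}) :
    ∃ (cneg : localPoints W (v.adicCompletion ℚ)) (c : ℕ → localPoints W (v.adicCompletion ℚ)),
      Summit.BirchSwinnertonDyer.Rank1Residual.F1Sign2.IsHondaSystemAtTwo κ
        (closureEmb (K := ℚ) (v.adicCompletion ℚ)) W (W.frobeniusTrace 2) g cneg c ∧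
      (∀ [NeZero (W.conductorNorm ℤ)] (f : CuspForm (Gamma0 (W.conductorNorm ℤ)) 2),
          IsNewformOf W f → ∀ (ϖ : ℚ), (ϖ : ℝ) * W.realPeriodRat = plusPeriod f →
        ∀ (Ls Lf : IwasawaAlgebra 2), IsSprungPair f 2 (W.frobeniusTrace 2) Ls Lf →
        ∀ [ContinuousSMul ℤ_[2] (W.tateModule 2)] [Module.Free ℤ_[2] (W.tateModule 2)]
          [Module.Finite ℤ_[2] (W.tateModule 2)] (I : Kato2004.IwasawaH1Data W 2 κ γ)
          (L : letI := moduleOfGenerator κ (closureEmb (K := ℚ) (v.adicCompletion ℚ)) W hg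
            I.H →ₗ[IwasawaAlgebra 2] (localTowerPointsOfEmb κ (closureEmb (K := ℚ) (v.adicCompletion ℚ)) W →+ ℤ_[2])),
          (∀ (x : I.H) (n k : ℕ) (Q : localPoints W (v.adicCompletion ℚ))
              (hQ : Q ∈ localLayerPointsOfEmb κ (closureEmb (K := ℚ) (v.adicCompletion ℚ)) W n),
              PadicInt.toZModPow k (L x ⟨Q, localLayerPointsOfEmb_le_localTowerPointsOfEmb κ _ W n hQ⟩) =
                CyclotomicLayer.tatePairingPk W κ v n k (I.proj n x) ⟨Q, hQ⟩) →
        ∀ (J : letI := moduleOfGenerator κ (closureEmb (K := ℚ) (v.adicCompletion ℚ)) W hg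
            (localTowerPointsOfEmb κ (closureEmb (K := ℚ) (v.adicCompletion ℚ)) W →+ ℤ_[2]) →ₗ[IwasawaAlgebra 2]
              IwasawaAlgebra 2 × IwasawaAlgebra 2),
          (∀ w, IsColemanPair κ (closureEmb (K := ℚ) (v.adicCompletion ℚ)) W (W.frobeniusTrace 2) g c w (J w).1 (J w).2) →
          ∃ (Z : Submodule (IwasawaAlgebra 2) I.H) (G : IwasawaAlgebra 2),
            (∃ z ∈ Z, (J (L z)).2 = G) ∧
            iwasawaToPowerSeries 2 G = PowerSeries.C (ϖ : ℚ_[2]) * iwasawaToPowerSeries 2 Lf ∧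
            (∃ s₀ : I.H, Z = Submodule.span (IwasawaAlgebra 2) {s₀} ∧
              ∀ 𝔭 : PrimeSpectrum (IwasawaAlgebra 2), 𝔭.asIdeal.height = 1 →
                PowerSeries.C (2 : ℤ_[2]) ∉ 𝔭.asIdeal →
                ∃ (M : IwasawaAlgebra 2) (s : I.H), M ∉ 𝔭.asIdeal ∧
                  Literature.NumberTheory.EllipticCurves.Kato2004.IsEulerSystemClassTwo W hκ I s ∧ s ≠ 0 ∧
                  M • s₀ = s)) := by
  -- E0b: THE Honda system with its model, logs and transport
  obtain ⟨Φ, φ, hΦφ, ι, hι, x, y, σ, N, d₀, cneg, c, hE0b⟩ :=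
    SSHondaTwo.isHondaSystemAtTwo_sprung_withLog W hss κ hκ v hv g hg
  obtain ⟨hx, hyΩ, hystab, hσ, hN, hd₀, hL₀, -, hc, hH⟩ := id hE0b
  refine ⟨cneg, c, hH, ?_⟩
  intro _ f hf ϖ hϖΩ Ls Lf hSP _ _ _ I L hLpin J hJ
  -- the local variable and its lift; the frames
  obtain ⟨g₀, g₁, -, -, hg₁, -, -, hζpow, -, hTg⟩ := LocalVar.exists_localVariable_two hκ hγ hγ' v Φ φ hΦφ ι hι
  obtain ⟨e, he⟩ := exists_algHom_cyclotomicField_zeta_eq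
  obtain ⟨τ, hτ⟩ := exists_tau_two
  obtain ⟨ιC, hιC⟩ := exists_ringHom_cyclotomicField_complex
  have heτ : ∀ (k : ℕ) (a : ZMod (2 ^ k)), IsUnit a →
      τ k a • e k (IsCyclotomicExtension.zeta (cycLevel 2 k ∅) ℚ (CyclotomicField (cycLevel 2 k ∅) ℚ)) =
        e k (IsCyclotomicExtension.zeta (cycLevel 2 k ∅) ℚ (CyclotomicField (cycLevel 2 k ∅) ℚ)) ^ a.val := by
    intro k a ha; rw [he k]; exact hτ k a ha
  have hcoh : ∀ k : ℕ, e (k + 1) (IsCyclotomicExtension.zeta (cycLevel 2 (k + 1) ∅) ℚ (CyclotomicField (cycLevel 2 (k + 1) ∅) ℚ)) ^ 2 =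
      e k (IsCyclotomicExtension.zeta (cycLevel 2 k ∅) ℚ (CyclotomicField (cycLevel 2 k ∅) ℚ)) := by
    intro k; rw [he, he]; exact zeta_succ_pow 2 k
  -- (P): Kato's (KZ) family at this frame, and its rational constant
  have hv' : ((2 : ℕ) : 𝓞 ℚ) ∈ v.asIdeal := by exact_mod_cast hv
  obtain ⟨κK, hκK, ΛK, hfam⟩ := hP v hv' W hss κ hκ f hf Φ φ hΦφ e τ hcoh heτ ιC hιC
  have hKato : ∀ (c d a : ℤ) (A : ℕ), 0 < A → Int.gcd c (6 * 2 * A) = 1 → Int.gcd d (6 * 2 * W.conductorNorm ℤ) = 1 →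
      ∃ (z : ∀ (k : ℕ) (r : (cyclotomicLevelsRat 2 (badPlaces c d A (W.conductorNorm ℤ))).Ideals),
            H1 (tateRep W 2) ((cyclotomicLevelsRat 2 (badPlaces c d A (W.conductorNorm ℤ))).level k r.1))
        (x : ∀ (k : ℕ) (r : (cyclotomicLevelsRat 2 (badPlaces c d A (W.conductorNorm ℤ))).Ideals),
            CyclotomicField (cycLevel 2 k r.1) ℚ),
        ZetaBody W 2 f ιC κK ΛK c d a A z x := fun c d a A hA hc hd ↦ by
    obtain ⟨z, x, h, -⟩ := hfam c d a A hA hc hd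
    exact ⟨z, x, h⟩
  obtain ⟨q, hq⟩ := KatoConst.exists_ratCast_eq_katoConstant_of_analyticRank_eq_zero hf hr 2 hKato
  -- the cusp family: one datum per height-one prime away from `2` (brick B1, Rohrlich-free)
  have h2N : ¬ 2 ∣ W.conductorNorm ℤ := not_dvd_level_of_isNewformOf hf hss.1
  choose cδ dδ aδ eeδ dδ' Dδ μt hgc hgd hdd' _hD hμ hμt using
    fun 𝔭 : {𝔭 : PrimeSpectrum (IwasawaAlgebra 2) // 𝔭.asIdeal.height = 1 ∧ PowerSeries.C (2 : ℤ_[2]) ∉ 𝔭.asIdeal} ↦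
      cuspBrick_of_isNewformOf hf h2N 𝔭.1 𝔭.2.1 𝔭.2.2
  -- the clauses of the Honda system E5 consumes
  obtain ⟨-, hcL, -, -, hTr, -⟩ := id hH
  have hTR : ∀ n, localTraceOfEmb κ (closureEmb (K := ℚ) (v.adicCompletion ℚ)) W (n + 1) (n + 2) (c (n + 2)) =
      W.frobeniusTrace 2 • c (n + 1) - c n := fun n ↦ by
    have h := hTr (n + 1) (Nat.le_add_left 1 n)
    rwa [Nat.add_sub_cancel] at h
  obtain ⟨-, hrank⟩ := h124.isTorsionFree_and_rank_le_one W 2 hκ hγ I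
  -- the core (C3a) and the coprimality off `(2)` (C2), exactly as in C3b
  letI := moduleOfGenerator κ (closureEmb (K := ℚ) (v.adicCompletion ℚ)) W hg
  obtain ⟨s, hES, hE3⟩ := exists_lifts_levelCongruences_of_katoFamily W hκ v hss Φ ι hx.1 hx.2.1 (hx.2.2 0) hN.1 hyΩ hystab hσ hd₀ hL₀
    hc hcL hTR hζpow hg₁ hg (hTg W) f hf I L hLpin e he τ hτ ιC hιC hq ΛK hfam cδ dδ aδ eeδ dδ' Dδ μt hgc hgd hdd' hμt
  have hap : (2 : ℤ) ∣ W.frobeniusTrace 2 := by exact_mod_cast hss.2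
  have hq0 : q ≠ 0 := by rintro rfl; exact hκK (by exact_mod_cast hq)
  have hN0 : (N : ℤ) ≠ 0 := by
    rcases Summit.BirchSwinnertonDyer.Rank1Residual.Supersingular.frobeniusTrace_two_eq_zero_or W hss.1 hap with h | h | h <;>
      · rw [hN.1, h]; norm_num
  have hNq : ((N : ℤ) * q.num : ℤ) ≠ 0 := mul_ne_zero hN0 (Rat.num_ne_zero.mpr hq0)
  have hLf : Lf ≠ 0 := SSFlatRoad.flat_ne_zero_two W hf hss.1 hap
    ((WeierstrassCurve.analyticRank_eq_zero_iff_holds (W := W) hf.hasEntireLFunction).mp hr) hSP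
  have hd : ((q.den : ℤ) : ℤ_[2]) ≠ 0 := by exact_mod_cast q.den_ne_zero
  have hcop := hcop_of_cuspFamily W hκ (closureEmb (K := ℚ) (v.adicCompletion ℚ)) hg hap I L J hJ f hSP hLf s hES Dδ μt hNq
    (fun 𝔭 h𝔭 h2 ↦ ⟨⟨𝔭, h𝔭, h2⟩, hμ ⟨𝔭, h𝔭, h2⟩⟩) hE3
  -- (B1)♭′ by name (Abbes–Ullmo at `2`, tower-1 GEN 70 B1d) and the (α) door
  have hϖ : 0 ≤ padicValRat 2 ϖ :=
    SSFlatERL.padicValRat_periodRatio_nonneg_of_goodSS_two_of_abbesUllmo hAU W hss f hf ϖ hϖΩ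
  exact SSFlatFold.flatZeta_fblock_of_levelCongruences_of_flatImage W v hss hκ hγ hg hap I hrank L J hJ f ϖ Ls Lf hSP hLf
    (fun δ ↦ (PowerSeries.C ((Dδ δ : ℤ) : ℤ_[2]) : IwasawaAlgebra 2) • s δ)
    (fun δ ↦ PowerSeries.C ((((N : ℤ) * q.num : ℤ) : ℤ_[2])) * μt δ) hd hE3 hcop
    (hα Φ φ hΦφ ι hι x y σ N d₀ cneg c hE0b I L hLpin J hJ) hϖ

end Door

end Summit.BirchSwinnertonDyer.BirchSwinnertonDyer.Theorems.SSFlatCap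

end
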